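import Summits.AtomisticToContinuum.FouriersLaw.Theses.PhononMeanFreePath
import Summits.AtomisticToContinuum.FouriersLaw.Theorems.PhononMeanFreePathDefs
import Summits.AtomisticToContinuum.FouriersLaw.Theorems.PhononMeanFreePathCoherentDephasingWeakCouplingIntegrability
import Summits.AtomisticToContinuum.FouriersLaw.Theorems.PhononMeanFreePathCoherentDephasingResponseRegularity
import Summits.AtomisticToContinuum.FouriersLaw.Theorems.PhononMeanFreePathCoherentDephasingMeanFieldDuhamel
import Summits.AtomisticToContinuum.FouriersLaw.Theorems.PhononMeanFreePathCoherentDephasingHarmFluxBound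
import Summits.AtomisticToContinuum.FouriersLaw.Theorems.PhononMeanFreePathCoherentDephasingSiteBookkeeping
import Summits.AtomisticToContinuum.FouriersLaw.Theorems.PhononMeanFreePathCoherentDephasingTelescoping
import Summits.AtomisticToContinuum.FouriersLaw.Theorems.PhononMeanFreePathCoherentDephasingLossComposition
import Summits.AtomisticToContinuum.FouriersLaw.Theorems.PhononMeanFreePathCoherentDephasingOfLocalLossBound
import Summits.AtomisticToContinuum.FouriersLaw.Theorems.PhononMeanFreePathCoherentDephasingResponseAbsBounds
import Summits.AtomisticToContinuum.FouriersLaw.Theorems.PhononMeanFreePathCoherentDephasingLifetimeOfBlockLoss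
import Summits.AtomisticToContinuum.FouriersLaw.Theorems.PhononMeanFreePathCoherentDephasingBulkContact

/-!
# The WEIGHTED coherent lifetime bound from a BLOCK loss bound (line `Sketch`, crux stmt-AtomisticToContinuum-11810)

Registered stub `weightedLifetime_of_blockLossBound` (step S1 ⇒ S3) of the lead's skeleton of line `Sketch`
(coherent-field Beer–Lambert) of the crux `PhononMeanFreePath.CoherentDephasing`. For the `(N+1)`-site pinned
anharmonic chain with Langevin baths at sites `0` and `N`, write `E_x = cohEnergy x ≥ 0` for the time-integrated
coherent site energies of the Gibbs-averaged linear response to a momentum kick at site `0`, `Ĵ_b = harmFlux b` for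
the symmetric harmonic fluxes and `s'_x = siteWork x + γ([x = 0] + [x = N]) ∫₀^∞ m_x²` for the total local loss. The
HYPOTHESIS is the open block loss bound of the line (verbatim the registered stub `stub_blockLossBound`): there are
`L₀ ≥ 1`, `L`, `N₀`, `κ > 0` with `κ Σ_{i<L₀} E_{x+i} ≤ Σ_{i<L₀} s'_{x+i}` for every block of `L₀` consecutive sites
`x, …, x + L₀ - 1` with `L ≤ x`, `x + L₀ ≤ N + 1`, of every chain with `N ≥ N₀`. The CLAIM is the `N`-uniform
WEIGHTED coherent lifetime bound `Σ_x (x+1)² E_x ≤ C` for all `N` (the hypothesis shape of the landed glue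
`…FarSiteEnergy.coherentDephasing_of_weightedCoherentLifetime`).

Proof. Landed inputs: the exact site balances `Ĵ_{x-1} - Ĵ_x = s'_x` (`1 ≤ x ≤ N`, `Ĵ_N := 0`) and the transport
bound `Ĵ_b ≤ E_b + E_{b+1}` of `…SiteBookkeeping` (applied to `…MeanFieldDuhamel`, `…ResponseRegularity`), and the
`N`-uniform absolute bounds `E_x ≤ B`, `|Ĵ_b| ≤ B` of `…ResponseAbsBounds`. For `N < N₀` the sum is at most
`(N₀+1)³ B`. For `N ≥ N₀`, with `L' = max L 1`, tile the sites from the RIGHT by `n = ⌊(N + 1 - L')/L₀⌋` blocks of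
`L₀` sites, the first one starting at `a = N + 1 - n L₀ ∈ [L', L' + L₀]` (as in `…LifetimeOfBlockLoss`). The
block-boundary fluxes `F_j = Ĵ_{a + jL₀ - 1}` are non-increasing and contract by `θ = 1/(1+κ)` every two blocks
(`…BulkContact.dissipation_le_geometric_bulkBlockLoss`), so `F_j ≤ B θ^{⌊j/2⌋}`, and the energy beyond the `j`-th
block boundary is at most `F_j / κ` (`…LifetimeOfBlockLoss.sum_Ico_le_of_blockLoss`). On block `j` the weight is
`(x+1)² ≤ W² (j+1)²`, `W = L' + 2L₀`, so the tail contributes `≤ (W² B/κ) Σ_j (j+1)² θ^{⌊j/2⌋}`, a series bounded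
independently of `n` (comparison with `Σ_j (j+1)² ρ^j / ρ`, `ρ = √θ < 1`, summable by
`summable_pow_mul_geometric_of_norm_lt_one`); the `a ≤ L' + L₀` head sites contribute `≤ (L' + L₀)³ B`.
-/

noncomputable section

open MeasureTheory Set Filter Topology

namespace Summit.AtomisticToContinuum.FouriersLaw.Theorems.CoherentDephasing.WeightedLifetimeOfBlockLoss

open Literature.MathematicalPhysics.KineticTheory.HeatConduction (pinnedChain PhaseSpace)
open Summit.AtomisticToContinuum.FouriersLaw.Theorems.PhononMeanFreePath
open Summit.AtomisticToContinuum.FouriersLaw.Theorems.CoherentDephasing.MeanFieldDuhamel (stub_meanFieldDuhamel)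
open Summit.AtomisticToContinuum.FouriersLaw.Theorems.CoherentDephasing.ResponseRegularity (stub_responseRegularity)
open Summit.AtomisticToContinuum.FouriersLaw.Theorems.CoherentDephasing.SiteBookkeeping (stub_siteBookkeeping_of_meanField)
open Summit.AtomisticToContinuum.FouriersLaw.Theorems.CoherentDephasing.ResponseAbsBounds (responseAbsBounds)
open Summit.AtomisticToContinuum.FouriersLaw.Theorems.CoherentDephasing.OfLocalLossBound
  (sum_ite_succ_eq sum_ite_val_eq_of_lt sum_ite_val_eq_zero)
open Summit.AtomisticToContinuum.FouriersLaw.Theorems.CoherentDephasing.LifetimeOfBlockLoss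
  (sum_Ico_eq_sum_blocks sum_Ico_le_of_blockLoss)
open Summit.AtomisticToContinuum.FouriersLaw.Theorems.CoherentDephasing.BulkContact
  (dissipation_le_geometric_bulkBlockLoss)

/-! ## Abstract part: geometric decay of the block energies, and the weight series -/

/-- **Geometric decay of the block energies** (abstract core). `J, s, E : ℕ → ℝ` (fluxes, total local losses, site
energies `≥ 0` of a chain with sites `0, …, N`, `J N = 0`), the sites `a, …, N` (`a ≥ 1`) tiled by `n` blocks of
`L₀ ≥ 1` sites (`a + n L₀ = N + 1`), site balances `J (x-1) - J x = s x` for `a ≤ x ≤ N`, the block loss bound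
`κ Σ_block E ≤ Σ_block s` (`κ > 0`) on each block, transport `J b ≤ E b + E (b+1)` for `a ≤ b < N` and the head
bound `J (a-1) ≤ B`. Then the `j`-th block carries energy `κ Σ_{block j} E ≤ max(B,0) · (1+κ)^{-⌊j/2⌋}`: the flux into
block `j` has decayed geometrically (two-step contraction of the block-boundary fluxes) and dominates `κ ×` the energy
beyond it (losses telescope, block bounds add up). [folklore] -/
theorem blockEnergy_le_geometric (J s E : ℕ → ℝ) (κ B : ℝ) (N a n L₀ : ℕ) (hκ : 0 < κ) (hL₀ : 0 < L₀)
    (ha : 1 ≤ a) (htile : a + n * L₀ = N + 1) (hJN : J N = 0) (hhead : J (a - 1) ≤ B)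
    (hbal : ∀ x, a ≤ x → x ≤ N → J (x - 1) - J x = s x)
    (hloss : ∀ j, j < n →
      κ * ∑ i ∈ Finset.range L₀, E (a + j * L₀ + i) ≤ ∑ i ∈ Finset.range L₀, s (a + j * L₀ + i))
    (htr : ∀ b, a ≤ b → b < N → J b ≤ E b + E (b + 1)) (hE : ∀ x, 0 ≤ E x) (j : ℕ) (hj : j < n) :
    κ * ∑ i ∈ Finset.range L₀, E (a + j * L₀ + i) ≤ max B 0 * (1 / (1 + κ)) ^ (j / 2) := by
  have hmuln : j * L₀ + L₀ ≤ n * L₀ := by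
    have h := Nat.mul_le_mul_right L₀ (Nat.succ_le_of_lt hj)
    rwa [Nat.succ_mul] at h
  -- the flux into block `j` (through the bond `a + jL₀ - 1`) has decayed geometrically
  have hF : J (a + j * L₀ - 1) ≤ max B 0 * (1 / (1 + κ)) ^ (j / 2) := by
    have h := dissipation_le_geometric_bulkBlockLoss J s E (J (a + j * L₀ - 1)) B κ 0 (a + j * L₀ - 1) a L₀ j hκ
      le_rfl hL₀ ha (by omega) (fun x hx1 hx2 => hbal x hx1 (by omega)) (fun j' hj' => hloss j' (hj'.trans hj))
      (fun b hb1 hb2 => htr b hb1 (by omega)) hE hhead (by rw [add_zero, one_mul]; exact le_max_left _ _)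
    rwa [add_zero, one_mul] at h
  -- and dominates `κ ×` the energy of the sites `a + jL₀, …, N` beyond it
  have htail : κ * ∑ x ∈ Finset.Ico (a + j * L₀) (N + 1), E x ≤ J (a + j * L₀ - 1) := by
    refine sum_Ico_le_of_blockLoss J s E κ _ N (a + j * L₀) (n - j) L₀ (by rw [Nat.sub_mul]; omega) hJN le_rfl
      (fun x hx1 hx2 => hbal x (by omega) hx2) fun j' hj' => ?_
    rw [show a + j * L₀ + j' * L₀ = a + (j + j') * L₀ by ring]
    exact hloss (j + j') (by omega)
  -- block `j` is a part of those sites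
  have hsub : ∑ i ∈ Finset.range L₀, E (a + j * L₀ + i) ≤ ∑ x ∈ Finset.Ico (a + j * L₀) (N + 1), E x := by
    rw [show ∑ i ∈ Finset.range L₀, E (a + j * L₀ + i) = ∑ x ∈ Finset.Ico (a + j * L₀) (a + j * L₀ + L₀), E x by
      rw [Finset.sum_Ico_eq_sum_range, Nat.add_sub_cancel_left]]
    exact Finset.sum_le_sum_of_subset_of_nonneg (Finset.Ico_subset_Ico_right (by omega)) fun x _ _ => hE x
  exact ((mul_le_mul_of_nonneg_left hsub hκ.le).trans htail).trans hF

/-- **The weight series.** For `0 < θ < 1` the partial sums `Σ_{j<n} (j+1)² θ^{⌊j/2⌋}` are bounded independently of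
`n`: with `ρ = √θ ∈ (0,1)`, `θ^{⌊j/2⌋} ≤ ρ^j / ρ` and `Σ_j (j+1)² ρ^j < ∞`. [folklore] -/
theorem partialSum_sq_mul_pow_half_le (θ : ℝ) (hθ0 : 0 < θ) (hθ1 : θ < 1) :
    ∃ S : ℝ, ∀ n : ℕ, ∑ j ∈ Finset.range n, ((j : ℝ) + 1) ^ 2 * θ ^ (j / 2) ≤ S := by
  obtain ⟨ρ, hρ0, hρ1, rfl⟩ : ∃ ρ : ℝ, 0 < ρ ∧ ρ < 1 ∧ ρ ^ 2 = θ :=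
    ⟨Real.sqrt θ, Real.sqrt_pos.2 hθ0, (Real.sqrt_lt_sqrt hθ0.le hθ1).trans_eq Real.sqrt_one, Real.sq_sqrt hθ0.le⟩
  have hnorm : ‖ρ‖ < 1 := by rwa [Real.norm_of_nonneg hρ0.le]
  -- summable majorant `(j+1)² ρ^j = j² ρ^j + 2 (j ρ^j) + ρ^j`
  have hg : Summable (fun j : ℕ => ((j : ℝ) + 1) ^ 2 * ρ ^ j) := by
    have h0 := summable_geometric_of_lt_one hρ0.le hρ1
    have h1 := summable_pow_mul_geometric_of_norm_lt_one 1 hnorm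
    have h2 := summable_pow_mul_geometric_of_norm_lt_one 2 hnorm
    refine (h2.add ((h1.mul_left 2).add h0)).congr fun j => ?_
    ring
  -- `θ^{⌊j/2⌋} ρ = ρ^{2⌊j/2⌋ + 1} ≤ ρ^j` as `j ≤ 2⌊j/2⌋ + 1`
  have hcmp : ∀ j : ℕ, (ρ ^ 2) ^ (j / 2) ≤ ρ ^ j / ρ := fun j => by
    rw [le_div_iff₀ hρ0, ← pow_mul, ← pow_succ]
    exact pow_le_pow_of_le_one hρ0.le hρ1.le (by omega)
  refine ⟨(∑' j : ℕ, ((j : ℝ) + 1) ^ 2 * ρ ^ j) / ρ, fun n => ?_⟩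
  calc ∑ j ∈ Finset.range n, ((j : ℝ) + 1) ^ 2 * (ρ ^ 2) ^ (j / 2)
      ≤ ∑ j ∈ Finset.range n, ((j : ℝ) + 1) ^ 2 * ρ ^ j / ρ := Finset.sum_le_sum fun j _ => by
        rw [mul_div_assoc]
        exact mul_le_mul_of_nonneg_left (hcmp j) (by positivity)
    _ = (∑ j ∈ Finset.range n, ((j : ℝ) + 1) ^ 2 * ρ ^ j) / ρ := by rw [Finset.sum_div]
    _ ≤ (∑' j : ℕ, ((j : ℝ) + 1) ^ 2 * ρ ^ j) / ρ :=
        div_le_div_of_nonneg_right (hg.sum_le_tsum _ fun j _ => by positivity) hρ0.le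

/-! ## The stub: the weighted coherent lifetime bound from the block loss bound -/

/-- **Weighted coherent lifetime bound from the block loss bound** (registered stub
`weightedLifetime_of_blockLossBound` of line `Sketch`, step S1 ⇒ S3). If for every admissible parameter point there
are a block length `L₀ ≥ 1`, a head margin `L`, a threshold `N₀` and a rate `κ > 0` such that on every block of `L₀`
consecutive sites `x, …, x + L₀ - 1` with `L ≤ x`, `x + L₀ ≤ N + 1` of every chain with `N ≥ N₀` the total local loss
dominates `κ ×` the coherent energy, then the WEIGHTED time-integrated coherent energy `Σ_x (x+1)² cohEnergy x` is
bounded uniformly in `N`. Proof: for `N < N₀` each of the `N + 1` terms is `≤ (N+1)² B`; for `N ≥ N₀` tile the sites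
from the far bath by blocks of `L₀` sites down to a head of `≤ max L 1 + L₀` sites (`≤ (max L 1 + L₀)³ B`); the `j`-th
block carries energy `≤ (B/κ) θ^{⌊j/2⌋}`, `θ = 1/(1+κ)` (`blockEnergy_le_geometric`) under a weight
`≤ (max L 1 + 2L₀)² (j+1)²`, and `Σ_j (j+1)² θ^{⌊j/2⌋}` is bounded (`partialSum_sq_mul_pow_half_le`). [folklore] -/
theorem weightedLifetime_of_blockLossBound :
    (∀ ω₂ lam β γ : ℝ, 0 < ω₂ → 0 < lam → 0 < β → 0 < γ → ∀ T : ℝ, 0 < T →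
      ∃ L₀ L N₀ : ℕ, ∃ κ : ℝ, 0 < L₀ ∧ 0 < κ ∧ ∀ N : ℕ, N₀ ≤ N → ∀ (x : ℕ) (hx : x + L₀ ≤ N + 1), L ≤ x →
        κ * ∑ i : Fin L₀, cohEnergy ω₂ lam β γ T N ⟨x + i, by omega⟩ ≤
          ∑ i : Fin L₀, (siteWork ω₂ lam β γ T N ⟨x + i, by omega⟩ +
            γ * ((if x + (i : ℕ) = 0 then 1 else 0) + (if x + (i : ℕ) = N then 1 else 0)) *
              ∫ t in Set.Ioi (0 : ℝ), momResp ω₂ lam β γ T N ⟨x + i, by omega⟩ t ^ 2)) →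
    ∀ ω₂ lam β γ : ℝ, 0 < ω₂ → 0 < lam → 0 < β → 0 < γ → ∀ T : ℝ, 0 < T →
      ∃ C : ℝ, ∀ N : ℕ, ∑ x : Fin (N + 1), ((x : ℝ) + 1) ^ 2 * cohEnergy ω₂ lam β γ T N x ≤ C := by
  intro hLoss ω₂ lam β γ hω hl hβ hγ T hT
  obtain ⟨L₀, L, N₀, κ, hL₀, hκ, hloss⟩ := hLoss ω₂ lam β γ hω hl hβ hγ T hT
  obtain ⟨B, hB⟩ := responseAbsBounds ω₂ lam β γ hω hl hβ hγ T hT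
  have hB0 : 0 ≤ B := (cohEnergy_nonneg ω₂ lam β γ T 0 hω.le 0).trans ((hB 0).1 0).1
  -- head margin `L' = max L 1`, weight scale `W = L' + 2 L₀`
  obtain ⟨L', hLL', h1L'⟩ : ∃ L' : ℕ, L ≤ L' ∧ 1 ≤ L' := ⟨max L 1, le_max_left L 1, le_max_right L 1⟩
  obtain ⟨W, hW⟩ : ∃ W : ℕ, W = L' + 2 * L₀ := ⟨_, rfl⟩
  -- the weight series for the ratio `θ = 1/(1+κ)`
  have hθ0 : (0 : ℝ) < 1 / (1 + κ) := by positivity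
  have hθ1 : 1 / (1 + κ) < (1 : ℝ) := by rw [div_lt_one (by positivity)]; linarith
  obtain ⟨S, hS⟩ := partialSum_sq_mul_pow_half_le (1 / (1 + κ)) hθ0 hθ1
  have hS0 : 0 ≤ S := by simpa using hS 0
  have hsmall0 : 0 ≤ ((N₀ : ℝ) + 1) ^ 3 * B := by positivity
  have hlarge0 : 0 ≤ ((L' + L₀ : ℕ) : ℝ) ^ 3 * B + (W : ℝ) ^ 2 * (B / κ) * S := by positivity
  refine ⟨((N₀ : ℝ) + 1) ^ 3 * B + (((L' + L₀ : ℕ) : ℝ) ^ 3 * B + (W : ℝ) ^ 2 * (B / κ) * S), fun N => ?_⟩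
  by_cases hN : N₀ ≤ N
  swap
  · -- the finitely many `N < N₀`: each of the `N + 1` terms is `≤ (N+1)² B`
    have h1 : ∀ x : Fin (N + 1), ((x : ℝ) + 1) ^ 2 * cohEnergy ω₂ lam β γ T N x ≤ ((N : ℝ) + 1) ^ 2 * B := by
      intro x
      have hx : ((x : ℕ) : ℝ) + 1 ≤ (N : ℝ) + 1 := by exact_mod_cast Nat.add_one_le_iff.mpr x.isLt
      exact mul_le_mul (pow_le_pow_left₀ (by positivity) hx 2) ((hB N).1 x).1
        (cohEnergy_nonneg ω₂ lam β γ T N hω.le x) (by positivity)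
    have hNN₀ : (N : ℝ) + 1 ≤ (N₀ : ℝ) + 1 := by
      have : (N : ℝ) ≤ N₀ := Nat.cast_le.mpr (by omega)
      linarith
    calc ∑ x : Fin (N + 1), ((x : ℝ) + 1) ^ 2 * cohEnergy ω₂ lam β γ T N x
        ≤ ∑ _x : Fin (N + 1), ((N : ℝ) + 1) ^ 2 * B := Finset.sum_le_sum fun x _ => h1 x
      _ = ((N : ℝ) + 1) ^ 3 * B := by
          simp only [Finset.sum_const, Finset.card_univ, Fintype.card_fin, nsmul_eq_mul, Nat.cast_add,
            Nat.cast_one]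
          ring
      _ ≤ ((N₀ : ℝ) + 1) ^ 3 * B := mul_le_mul_of_nonneg_right (pow_le_pow_left₀ (by positivity) hNN₀ 3) hB0
      _ ≤ _ := le_add_of_nonneg_right hlarge0
  · -- `N ≥ N₀`: the exact site balances and the transport bound of the chain with sites `0, …, N`
    obtain ⟨hbal, htr⟩ := stub_siteBookkeeping_of_meanField ω₂ lam β γ hω hl hβ hγ T hT N
      (stub_meanFieldDuhamel ω₂ lam β γ hω hl hβ hγ T hT N) (stub_responseRegularity ω₂ lam β γ hω hl hβ hγ T hT N)
    -- tiling of the sites `a, …, N` from the right by `n` blocks of `L₀` sites; `1 ≤ a ≤ L' + L₀`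
    obtain ⟨n, hn⟩ : ∃ n : ℕ, n = (N + 1 - L') / L₀ := ⟨_, rfl⟩
    have hnle : n * L₀ ≤ N + 1 - L' := by rw [hn]; exact Nat.div_mul_le_self _ _
    have hnlt : N + 1 - L' < n * L₀ + L₀ := by rw [hn]; exact Nat.lt_div_mul_add hL₀
    obtain ⟨a, ha⟩ : ∃ a : ℕ, a = N + 1 - n * L₀ := ⟨_, rfl⟩
    have htile : a + n * L₀ = N + 1 := by omega
    have haN : a ≤ N + 1 := by omega
    have haL : a ≤ L' + L₀ := by omega
    have ha1 : 1 ≤ a := by omega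
    -- `ℕ`-indexed flux `J`, total local loss `s` and site energy `E` (junk `0` out of range)
    obtain ⟨J, hJ⟩ : ∃ J : ℕ → ℝ, J = fun b => if h : b < N then harmFlux ω₂ lam β γ T N ⟨b, h⟩ else 0 := ⟨_, rfl⟩
    obtain ⟨s, hs⟩ : ∃ s : ℕ → ℝ, s = fun y => if h : y < N + 1 then siteWork ω₂ lam β γ T N ⟨y, h⟩ +
        γ * ((if y = 0 then 1 else 0) + (if y = N then 1 else 0)) *
          ∫ t in Set.Ioi (0 : ℝ), momResp ω₂ lam β γ T N ⟨y, h⟩ t ^ 2 else 0 := ⟨_, rfl⟩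
    obtain ⟨E, hE⟩ : ∃ E : ℕ → ℝ, E = fun y => if h : y < N + 1 then cohEnergy ω₂ lam β γ T N ⟨y, h⟩ else 0 :=
      ⟨_, rfl⟩
    have hE0 : ∀ y, 0 ≤ E y := fun y => by
      simp only [hE]
      split_ifs with h
      · exact cohEnergy_nonneg ω₂ lam β γ T N hω.le _
      · exact le_rfl
    have hEB : ∀ y, E y ≤ B := fun y => by
      simp only [hE]
      split_ifs with h
      · exact ((hB N).1 ⟨y, h⟩).1
      · exact hB0
    -- geometric decay of the block energies: `κ Σ_{block j} E ≤ B θ^{⌊j/2⌋}`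
    have hblk : ∀ j, j < n →
        κ * ∑ i ∈ Finset.range L₀, E (a + j * L₀ + i) ≤ max B 0 * (1 / (1 + κ)) ^ (j / 2) := by
      refine blockEnergy_le_geometric J s E κ B N a n L₀ hκ hL₀ ha1 htile ?_ ?_ ?_ ?_ ?_ hE0
      · -- `J N = 0`
        simp only [hJ, dif_neg (lt_irrefl N)]
      · -- `J (a-1) ≤ B`
        simp only [hJ]
        split_ifs with h
        · exact (le_abs_self _).trans ((hB N).2 ⟨a - 1, h⟩).1
        · exact hB0
      · -- the site balances at `a ≤ x ≤ N` (so `1 ≤ x`), read off the bookkeeping stub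
        intro x hx1 hx2
        have h := hbal ⟨x, by omega⟩
        rw [sum_ite_succ_eq N _ (show ((⟨x, by omega⟩ : Fin (N + 1)) : ℕ) - 1 < N by simp only; omega)
          (show ((⟨x, by omega⟩ : Fin (N + 1)) : ℕ) ≠ 0 by simp only; omega)] at h
        simp only at h
        rw [if_neg (show x ≠ 0 by omega), add_zero] at h
        simp only [hJ, hs]
        rw [dif_pos (show x - 1 < N by omega), dif_pos (show x < N + 1 by omega)]
        by_cases hxN : x = N
        · rw [sum_ite_val_eq_zero N _ (show ¬ ((⟨x, _⟩ : Fin (N + 1)) : ℕ) < N by simp only; omega)] at h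
          rw [dif_neg (show ¬ x < N by omega)]
          linarith
        · rw [sum_ite_val_eq_of_lt N _ (show ((⟨x, _⟩ : Fin (N + 1)) : ℕ) < N by simp only; omega)] at h
          simp only at h
          rw [dif_pos (show x < N by omega)]
          linarith
      · -- the block loss bounds on the `n` blocks (the hypothesis), moved to `range`-sums of `E`, `s`
        intro j hj
        have hjn : j * L₀ + L₀ ≤ n * L₀ := by
          have h := Nat.mul_le_mul_right L₀ (Nat.succ_le_of_lt hj)
          rwa [Nat.succ_mul] at h
        have h := hloss N hN (a + j * L₀) (by omega) (by omega)
        have e1 : ∑ i : Fin L₀, cohEnergy ω₂ lam β γ T N ⟨a + j * L₀ + i, by omega⟩ =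
            ∑ i : Fin L₀, E (a + j * L₀ + i) := by
          refine Finset.sum_congr rfl fun i _ => ?_
          simp only [hE]
          rw [dif_pos (show a + j * L₀ + (i : ℕ) < N + 1 by omega)]
        have e2 : ∑ i : Fin L₀, (siteWork ω₂ lam β γ T N ⟨a + j * L₀ + i, by omega⟩ +
              γ * ((if a + j * L₀ + (i : ℕ) = 0 then 1 else 0) + (if a + j * L₀ + (i : ℕ) = N then 1 else 0)) *
                ∫ t in Set.Ioi (0 : ℝ), momResp ω₂ lam β γ T N ⟨a + j * L₀ + i, by omega⟩ t ^ 2) =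
            ∑ i : Fin L₀, s (a + j * L₀ + i) := by
          refine Finset.sum_congr rfl fun i _ => ?_
          simp only [hs]
          rw [dif_pos (show a + j * L₀ + (i : ℕ) < N + 1 by omega)]
        rw [e1, e2] at h
        rw [Finset.sum_range, Finset.sum_range]
        exact h
      · -- transport across the bond `b`, read off the bookkeeping stub
        intro b _ hb
        simp only [hJ, hE]
        rw [dif_pos hb, dif_pos (show b < N + 1 by omega), dif_pos (show b + 1 < N + 1 by omega)]
        exact htr ⟨b, hb⟩
    -- assembly: the weighted `Fin`-sum as a `range`-sum, split into the head `y < a` and the tiled tail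
    have hsumE : ∑ x : Fin (N + 1), ((x : ℝ) + 1) ^ 2 * cohEnergy ω₂ lam β γ T N x =
        ∑ y ∈ Finset.range (N + 1), ((y : ℝ) + 1) ^ 2 * E y := by
      rw [Finset.sum_range]
      refine Finset.sum_congr rfl fun x _ => ?_
      simp only [hE]
      rw [dif_pos x.isLt]
    have hhead : ∑ y ∈ Finset.range a, ((y : ℝ) + 1) ^ 2 * E y ≤ ((L' + L₀ : ℕ) : ℝ) ^ 3 * B :=
      calc ∑ y ∈ Finset.range a, ((y : ℝ) + 1) ^ 2 * E y ≤ ∑ _y ∈ Finset.range a, (a : ℝ) ^ 2 * B := by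
            refine Finset.sum_le_sum fun y hy => ?_
            have hy' : (y : ℝ) + 1 ≤ (a : ℝ) := by exact_mod_cast Nat.add_one_le_iff.mpr (Finset.mem_range.1 hy)
            exact mul_le_mul (pow_le_pow_left₀ (by positivity) hy' 2) (hEB y) (hE0 y) (by positivity)
        _ = (a : ℝ) ^ 3 * B := by rw [Finset.sum_const, Finset.card_range, nsmul_eq_mul]; ring
        _ ≤ ((L' + L₀ : ℕ) : ℝ) ^ 3 * B :=
            mul_le_mul_of_nonneg_right (pow_le_pow_left₀ (Nat.cast_nonneg a) (Nat.cast_le.mpr haL) 3) hB0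
    have htail : ∑ y ∈ Finset.Ico a (N + 1), ((y : ℝ) + 1) ^ 2 * E y ≤ (W : ℝ) ^ 2 * (B / κ) * S := by
      rw [← htile, sum_Ico_eq_sum_blocks (fun y => ((y : ℝ) + 1) ^ 2 * E y) a L₀ n]
      -- block `j`: weight `≤ (W (j+1))²`, energy `≤ (B/κ) θ^{⌊j/2⌋}`
      have hj : ∀ j, j < n → ∑ i ∈ Finset.range L₀, (((a + j * L₀ + i : ℕ) : ℝ) + 1) ^ 2 * E (a + j * L₀ + i) ≤
          (W : ℝ) ^ 2 * (B / κ) * (((j : ℝ) + 1) ^ 2 * (1 / (1 + κ)) ^ (j / 2)) := by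
        intro j hjn
        have hjW : j * L₀ ≤ W * j := by rw [mul_comm W j]; exact Nat.mul_le_mul_left j (by omega)
        have hw : ∀ i ∈ Finset.range L₀,
            (((a + j * L₀ + i : ℕ) : ℝ) + 1) ^ 2 ≤ ((W : ℝ) * ((j : ℝ) + 1)) ^ 2 := by
          intro i hi
          rw [Finset.mem_range] at hi
          have h1 : a + j * L₀ + i + 1 ≤ W * (j + 1) := by rw [mul_add_one]; omega
          have h2 : ((a + j * L₀ + i : ℕ) : ℝ) + 1 ≤ (W : ℝ) * ((j : ℝ) + 1) := by exact_mod_cast h1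
          exact pow_le_pow_left₀ (by positivity) h2 2
        have hen : ∑ i ∈ Finset.range L₀, E (a + j * L₀ + i) ≤ B / κ * (1 / (1 + κ)) ^ (j / 2) := by
          have h := hblk j hjn
          rw [max_eq_left hB0] at h
          rw [div_mul_eq_mul_div, le_div_iff₀ hκ, mul_comm]
          exact h
        calc ∑ i ∈ Finset.range L₀, (((a + j * L₀ + i : ℕ) : ℝ) + 1) ^ 2 * E (a + j * L₀ + i)
            ≤ ∑ i ∈ Finset.range L₀, ((W : ℝ) * ((j : ℝ) + 1)) ^ 2 * E (a + j * L₀ + i) :=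
              Finset.sum_le_sum fun i hi => mul_le_mul_of_nonneg_right (hw i hi) (hE0 _)
          _ = ((W : ℝ) * ((j : ℝ) + 1)) ^ 2 * ∑ i ∈ Finset.range L₀, E (a + j * L₀ + i) := by
              rw [Finset.mul_sum]
          _ ≤ ((W : ℝ) * ((j : ℝ) + 1)) ^ 2 * (B / κ * (1 / (1 + κ)) ^ (j / 2)) :=
              mul_le_mul_of_nonneg_left hen (by positivity)
          _ = (W : ℝ) ^ 2 * (B / κ) * (((j : ℝ) + 1) ^ 2 * (1 / (1 + κ)) ^ (j / 2)) := by ring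
      calc ∑ j ∈ Finset.range n, ∑ i ∈ Finset.range L₀,
            (((a + j * L₀ + i : ℕ) : ℝ) + 1) ^ 2 * E (a + j * L₀ + i)
          ≤ ∑ j ∈ Finset.range n, (W : ℝ) ^ 2 * (B / κ) * (((j : ℝ) + 1) ^ 2 * (1 / (1 + κ)) ^ (j / 2)) :=
            Finset.sum_le_sum fun j hj' => hj j (Finset.mem_range.1 hj')
        _ = (W : ℝ) ^ 2 * (B / κ) * ∑ j ∈ Finset.range n, ((j : ℝ) + 1) ^ 2 * (1 / (1 + κ)) ^ (j / 2) := by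
            rw [Finset.mul_sum]
        _ ≤ (W : ℝ) ^ 2 * (B / κ) * S := mul_le_mul_of_nonneg_left (hS n) (by positivity)
    rw [hsumE, ← Finset.sum_range_add_sum_Ico (fun y => ((y : ℝ) + 1) ^ 2 * E y) haN]
    calc ∑ y ∈ Finset.range a, ((y : ℝ) + 1) ^ 2 * E y + ∑ y ∈ Finset.Ico a (N + 1), ((y : ℝ) + 1) ^ 2 * E y
        ≤ ((L' + L₀ : ℕ) : ℝ) ^ 3 * B + (W : ℝ) ^ 2 * (B / κ) * S := add_le_add hhead htail
      _ ≤ _ := le_add_of_nonneg_left hsmall0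

end Summit.AtomisticToContinuum.FouriersLaw.Theorems.CoherentDephasing.WeightedLifetimeOfBlockLoss

end
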